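import Literature.Analysis.FluidPDE.GalerkinSmoothCauchy
import Literature.Analysis.FluidPDE.ScalarFourierData
import HarnessLib

/-!
# Smooth short-time solutions by the Fourier–Galerkin energy method, III: the Galerkin limit

Analysis/FluidPDE proof file (theorems only), sequel of `GalerkinSmoothHm.lean` (uniform `H^m`
bounds) and `GalerkinSmoothCauchy.lean` (Cauchy property in `C([0,T]; L²)`). Following
A. J. Majda, A. L. Bertozzi, *Vorticity and Incompressible Flow*, CUP 2002, proof of Thm. 3.4
(pp. 108–110: the regularised solutions exist on a common interval, are uniformly bounded in the
high norms, converge in `C([0,T]; L²)`, and the limit inherits the bounds), this file constructs,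
for the damped Galerkin systems `β' = V(-σβ, β)` on `freqBall n` (viscosity `ν ≥ 0`, even
nonnegative damping symbol `σ`) with a real divergence-free rapidly decaying datum `a = û₀`:

* `exists_galerkinLimit` — on the life span `T c(d,B) √M ≤ 1` of part I (`U₄ ≤ M`,
  `∑_{k∈S}(1+|k|²)ᵐ‖a k‖² ≤ U_m`): the Galerkin solutions `βⁿ` (global, in the Galerkin phase
  spaces), uniform weighted bounds `∑_{k}(1+|k|²)ᵐ‖β̄ⁿ(t)_k‖² ≤ R_m` on `[0,T]` for **every** `m`
  (part I), the Cauchy bound `‖β̄ⁿ'(t) - β̄ⁿ(t)‖²_{ℓ²} ≤ η_n → 0` (part II with `s = 1`, and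
  `gronwallBound δ K ε t ≤ (δ + εt)e^{Kt}`), and the **limit coefficient curve**
  `c(t)_k = lim_n β̄ⁿ(t)_k` (uniformly on `[0,T]`): `c(0) = a`, `c(t)` real
  (`IsConjSymm`) and divergence free (transversal), `∑_{k∈F}(1+|k|²)ᵐ‖c(t)_k‖² ≤ R_m` for all
  finite `F`, continuity of `t ↦ c(t)_k` on `[0,T]`, and `‖c(t)_k - β̄ⁿ(t)_k‖² ≤ η_n`.
* helpers: `gronwallBound_le_mul_exp`, `sum_coeffExt_le_sum`, and the passage from weighted
  `ℓ²` bounds to the weighted sup-norm decay `FourierNS.HasDecay` used by the tree's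
  Fourier-side families (`hasDecay_of_weighted_sq_le`).

The differential equation satisfied by the limit (mode by mode, within `[0,T]`) and the bootstrap
of its time derivatives are the subject of the sequel files.

## References

* A. J. Majda, A. L. Bertozzi, *Vorticity and Incompressible Flow*, CUP 2002, §3.2.2, Thm. 3.4
  and its proof, pp. 104–110. [`MajdaBertozziCUP2002`]
* J. C. Robinson, J. L. Rodrigo, W. Sadowski, *The three-dimensional Navier–Stokes equations*,
  CUP 2016, §4.1. [`RobinsonRodrigoSadowski2016`]
-/

noncomputable section

open MeasureTheory Set Filter Topology Function UnitAddTorus Metric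
open scoped ENNReal NNReal InnerProductSpace ContDiff

namespace Literature.Analysis.FluidPDE

namespace GalerkinSmooth

open FunctionSpaces FunctionSpaces.Torus Torus EulerGalerkin
open FourierNS (HasDecay)
open ScalarFourier (lconv dsym transportSym latOrder latMass)

variable {d : Type*} [Fintype d] [DecidableEq d]

/-! ## Elementary helpers -/

section Helpers

omit [Fintype d] [DecidableEq d] in
/-- **Explicit bound for the Grönwall bound**: `gronwallBound δ K ε x ≤ (δ + ε x) e^{Kx}` for
`δ, K, ε, x ≥ 0`. [folklore] -/
theorem gronwallBound_le_mul_exp {δ K ε x : ℝ} (hK : 0 ≤ K) (hε : 0 ≤ ε) (hx : 0 ≤ x) :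
    gronwallBound δ K ε x ≤ (δ + ε * x) * Real.exp (K * x) := by
  have hexp1 : 1 ≤ Real.exp (K * x) := Real.one_le_exp (mul_nonneg hK hx)
  by_cases hK0 : K = 0
  · rw [hK0, gronwallBound_K0]
    simp only [zero_mul, Real.exp_zero, mul_one, le_refl]
  · rw [gronwallBound_of_K_ne_0 hK0]
    have hKpos : 0 < K := lt_of_le_of_ne hK (Ne.symm hK0)
    have h1 : Real.exp (K * x) - 1 ≤ (K * x) * Real.exp (K * x) := by
      -- `e^y - 1 ≤ y e^y` from `1 - y ≤ e^{-y}`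
      have h := Real.add_one_le_exp (-(K * x))
      have hpos := Real.exp_pos (K * x)
      have hprod : Real.exp (-(K * x)) * Real.exp (K * x) = 1 := by rw [← Real.exp_add]; simp
      nlinarith [mul_le_mul_of_nonneg_right h hpos.le]
    have h2 : ε / K * (Real.exp (K * x) - 1) ≤ ε * x * Real.exp (K * x) := by
      calc ε / K * (Real.exp (K * x) - 1) ≤ ε / K * ((K * x) * Real.exp (K * x)) :=
            mul_le_mul_of_nonneg_left h1 (div_nonneg hε hK)
        _ = ε * x * Real.exp (K * x) := by field_simp
    show δ * Real.exp (K * x) + ε / K * (Real.exp (K * x) - 1) ≤ (δ + ε * x) * Real.exp (K * x)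
    nlinarith

omit [DecidableEq d] in
/-- Weighted sums of an extension by zero over any finite set are dominated by the sum over the
support. [folklore] -/
theorem sum_coeffExt_le_sum {S F : Finset (d → ℤ)} (w : (d → ℤ) → ℝ) (hw : ∀ k, 0 ≤ w k)
    (b : ↥S → EuclideanSpace ℂ d) :
    ∑ k ∈ F, w k * ‖coeffExt S b k‖ ^ 2 ≤ ∑ k ∈ S, w k * ‖coeffExt S b k‖ ^ 2 := by
  classical
  rw [← Finset.sum_filter_add_sum_filter_not F (· ∈ S)]
  have h0 : ∑ k ∈ F.filter (fun k => ¬ k ∈ S), w k * ‖coeffExt S b k‖ ^ 2 = 0 :=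
    Finset.sum_eq_zero fun k hk => by
      rw [coeffExt_of_not_mem b (Finset.mem_filter.1 hk).2, norm_zero]; ring
  rw [h0, add_zero]
  exact Finset.sum_le_sum_of_subset_of_nonneg (fun k hk => (Finset.mem_filter.1 hk).2)
    fun k _ _ => mul_nonneg (hw k) (sq_nonneg _)

omit [DecidableEq d] in
/-- From the weighted-`ℓ²` bound to pointwise decay:
`(1+|k|²)^{2p} ‖c k‖² ≤ R` for all finite partial sums gives `‖c k‖ ≤ √R ((1+|k|²)ᵖ)⁻¹`. [folklore] -/
theorem norm_le_of_weighted_sq_le {c : (d → ℤ) → EuclideanSpace ℂ d} {R : ℝ} {p : ℕ}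
    (h : ∀ k, (1 + freqNormSq k) ^ (2 * p) * ‖c k‖ ^ 2 ≤ R) (k : d → ℤ) :
    ‖c k‖ ≤ Real.sqrt R * ((1 + freqNormSq k) ^ p)⁻¹ := by
  have hw : 0 < (1 + freqNormSq k) ^ p := pow_pos (by linarith [freqNormSq_nonneg k]) p
  have h1 : ((1 + freqNormSq k) ^ p * ‖c k‖) ^ 2 ≤ R := by
    calc ((1 + freqNormSq k) ^ p * ‖c k‖) ^ 2 = (1 + freqNormSq k) ^ (2 * p) * ‖c k‖ ^ 2 := by
          rw [mul_pow, ← pow_mul, Nat.mul_comm]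
      _ ≤ R := h k
  have h2 : (1 + freqNormSq k) ^ p * ‖c k‖ ≤ Real.sqrt R := by
    have := Real.sqrt_le_sqrt h1
    rwa [Real.sqrt_sq (by positivity)] at this
  rw [← div_eq_mul_inv, le_div_iff₀ hw, mul_comm]
  exact h2

/-- **Sup-norm decay from the weighted bounds**: `HasDecay (2p) (2ᵖ √R) c` whenever
`(1+|k|²)^{2p} ‖c k‖² ≤ R` for all `k` (`ScalarFourier.hasDecay_of_freqNormSq_bound`, applied to
`ℂ^d`-valued coefficients through their components' common bound). [folklore] -/
theorem hasDecay_of_weighted_sq_le {c : (d → ℤ) → EuclideanSpace ℂ d} {R : ℝ} {p : ℕ}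
    (h : ∀ k, (1 + freqNormSq k) ^ (2 * p) * ‖c k‖ ^ 2 ≤ R) :
    HasDecay (2 * p) (2 ^ p * Real.sqrt R) c := by
  intro k
  have hpos : 0 < (1 + freqNormSq k) ^ p := pow_pos (by linarith [freqNormSq_nonneg k]) p
  have hpos' : 0 < (1 + ‖k‖) ^ (2 * p) := by positivity
  have hle : (1 + ‖k‖) ^ (2 * p) ≤ 2 ^ p * (1 + freqNormSq k) ^ p := by
    rw [pow_mul, ← mul_pow]
    exact pow_le_pow_left₀ (by positivity) (ScalarFourier.one_add_norm_sq_le k) p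
  calc ‖c k‖ ≤ Real.sqrt R * ((1 + freqNormSq k) ^ p)⁻¹ := norm_le_of_weighted_sq_le h k
    _ ≤ Real.sqrt R * (2 ^ p * ((1 + ‖k‖) ^ (2 * p))⁻¹) := by
        refine mul_le_mul_of_nonneg_left ?_ (Real.sqrt_nonneg _)
        rw [← div_eq_mul_inv, le_div_iff₀ hpos', inv_mul_eq_div, div_le_iff₀ hpos]
        exact hle
    _ = 2 ^ p * Real.sqrt R * ((1 + ‖k‖) ^ (2 * p))⁻¹ := by ring

end Helpers

/-! ## The Galerkin sequence and its limit -/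

section Limit

/-- **The Galerkin limit** (Majda–Bertozzi 2002, Thm. 3.4, proof, pp. 108–110: the regularised
solutions `v^ε` exist on a common interval `[0, T]` determined by the `H^m` norm of the datum,
are bounded there in every `H^{m'}`, form a Cauchy sequence in `C([0,T]; L²)`, and "the limit `v`
… belongs to `C([0,T]; H^{m'})`"). Fourier–Galerkin version on `T^d` for the damped system
`∂ₜc = V(-σc, c)` with viscosity `ν ≥ 0` and an even nonnegative symbol `σ`: for a real
divergence-free datum `a = û₀` with finite Sobolev sums `∑(1+|k|²)ᵐ‖a k‖² ≤ U_m` and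
`U₄ ≤ M`, on the life span `T c(d,B) √M ≤ 1` of part I there are: the Galerkin solutions
`βⁿ` on `freqBall n` with datum `a|_{freqBall n}`, uniform weighted bounds `R_m`, and a limit
coefficient curve `c : [0,T] → (ℤ^d → ℂ^d)` with `c(0) = a`, real and divergence free,
`∑_{k∈F} (1+|k|²)ᵐ ‖c(t)_k‖² ≤ R_m` for every finite `F`, continuous in `t` at each mode, and
`‖c(t)_k - β̄ⁿ(t)_k‖² ≤ η_n → 0` uniformly in `t ∈ [0,T]` and `k`. [cite: MajdaBertozziCUP2002, Thm. 3.4 proof (pp. 108–110)] -/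
theorem exists_galerkinLimit {B : ℝ} (hB : ∀ S : Finset (d → ℤ), ∑ k ∈ S, ((1 + freqNormSq k) ^ 2)⁻¹ ≤ B)
    {ν : ℝ} (hν : 0 ≤ ν) {σ : (d → ℤ) → ℝ} (hσ : ∀ k, 0 ≤ σ k) (hσe : ∀ k, σ (-k) = σ k)
    {a : (d → ℤ) → EuclideanSpace ℂ d} (ha : IsConjSymm a) (haT : ∀ k : d → ℤ, ∑ j, (k j : ℂ) * a k j = 0)
    {U : ℕ → ℝ} (hU : ∀ (m : ℕ) (S : Finset (d → ℤ)), ∑ k ∈ S, (1 + freqNormSq k) ^ m * ‖a k‖ ^ 2 ≤ U m)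
    {M : ℝ} (hM : 0 < M) (hMU : U 4 ≤ M) {T : ℝ} (hT0 : 0 ≤ T)
    (hT : T * (((Fintype.card d * (2 * (2 ^ 4 * (Fintype.card d * Real.sqrt B * (2 * Real.pi) ^ (2 * 4 + 1)))) *
          (((Fintype.card d : ℝ) + 1) ^ 3 * Real.sqrt (((Fintype.card d : ℝ) + 1) ^ 3)) + 1) *
          Real.sqrt (1 + Fintype.card d * (2 * Real.pi) ^ (2 * 4))) * Real.sqrt M) ≤ 1) :
    ∃ (β : (n : ℕ) → ℝ → ↥(freqBall (d := d) n) → EuclideanSpace ℂ d)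
      (c : ℝ → (d → ℤ) → EuclideanSpace ℂ d) (R : ℕ → ℝ) (η : ℕ → ℝ),
      (∀ n, β n 0 = fun k : ↥(freqBall (d := d) n) => a k) ∧
      (∀ n t, β n t ∈ galerkinSubspace (freqBall n)) ∧
      (∀ n, Continuous (β n)) ∧
      (∀ n T', ∀ t ∈ Icc 0 T', HasDerivWithinAt (β n)
        (galerkinRHS (freqBall n) ν (fun k : ↥(freqBall (d := d) n) => -((((σ (k : d → ℤ)) : ℝ) : ℂ) • β n t k))
          (β n t)) (Icc 0 T') t) ∧
      (∀ m, 0 ≤ R m) ∧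
      (∀ m n, ∀ t ∈ Icc 0 T,
        ∑ k ∈ freqBall n, (1 + freqNormSq k) ^ m * ‖coeffExt (freqBall n) (β n t) k‖ ^ 2 ≤ R m) ∧
      (∀ n, 0 ≤ η n) ∧ Tendsto η atTop (𝓝 0) ∧
      (∀ n, ∀ t ∈ Icc 0 T, ∀ k, ‖c t k - coeffExt (freqBall n) (β n t) k‖ ^ 2 ≤ η n) ∧
      c 0 = a ∧
      (∀ t ∈ Icc 0 T, IsConjSymm (c t)) ∧
      (∀ t ∈ Icc 0 T, ∀ k : d → ℤ, ∑ j, (k j : ℂ) * c t k j = 0) ∧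
      (∀ m, ∀ t ∈ Icc 0 T, ∀ F : Finset (d → ℤ), ∑ k ∈ F, (1 + freqNormSq k) ^ m * ‖c t k‖ ^ 2 ≤ R m) ∧
      (∀ k, ContinuousOn (fun t => c t k) (Icc 0 T)) := by
  have hB0 : 0 ≤ B := le_trans (Finset.sum_nonneg fun k _ => inv_nonneg.2 (sq_nonneg _)) (hB ∅)
  have hS : ∀ n, ∀ k ∈ freqBall (d := d) n, -k ∈ freqBall (d := d) n := fun n => neg_mem_freqBall_of_mem
  -- Step 1: the Galerkin solutions
  have hmem0 : ∀ n, (fun k : ↥(freqBall (d := d) n) => a k) ∈ galerkinSubspace (freqBall n) := fun n =>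
    ⟨isRealCoeff_restrict ha, isSolenoidalCoeff_restrict fun k _ => haT k⟩
  have hex : ∀ n, ∃ β : ℝ → ↥(freqBall (d := d) n) → EuclideanSpace ℂ d, β 0 = (fun k : ↥(freqBall (d := d) n) => a k) ∧
      (∀ t, β t ∈ galerkinSubspace (freqBall n)) ∧ Continuous β ∧
      ∀ T', ∀ t ∈ Icc 0 T', HasDerivWithinAt β
        (galerkinRHS (freqBall n) ν (fun k : ↥(freqBall (d := d) n) => -((((σ (k : d → ℤ)) : ℝ) : ℂ) • β t k)) (β t))
          (Icc 0 T') t := fun n =>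
    exists_dampedGalerkin_solution (hS n) hν hσ hσe (hmem0 n)
  choose β hβ0 hβmem hβcont hβderiv using hex
  -- Step 2: uniform weighted bounds of all orders
  have hW0 : ∀ n m, ∑ k ∈ freqBall n, (1 + freqNormSq k) ^ m * ‖coeffExt (freqBall n) (β n 0) k‖ ^ 2 ≤ U m := by
    intro n m
    refine le_trans (Finset.sum_le_sum fun k hk => ?_) (hU m (freqBall n))
    rw [hβ0 n, coeffExt_of_mem _ hk]
  have hR4 : ∀ m, 4 ≤ m → ∃ Rm : ℝ, 0 ≤ Rm ∧ ∀ n, ∀ t ∈ Icc 0 T,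
      ∑ k ∈ freqBall n, (1 + freqNormSq k) ^ m * ‖coeffExt (freqBall n) (β n t) k‖ ^ 2 ≤ Rm := by
    intro m hm
    obtain ⟨Φ, hΦmono, hΦnn, hΦ⟩ := sobolev_bounds_allOrders (d := d) B m hm
    refine ⟨Φ M (U m), hΦnn M hM _, fun n t ht => ?_⟩
    have h := hΦ (freqBall n) (hS n) (hB _) ν hν σ hσ T (β n) (hβderiv n T) (fun t _ => hβmem n t) M hM
      ((hW0 n 4).trans hMU) hT t ht
    exact h.trans (hΦmono M hM (hW0 n m))
  have hRall : ∀ m, ∃ Rm : ℝ, 0 ≤ Rm ∧ ∀ n, ∀ t ∈ Icc 0 T,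
      ∑ k ∈ freqBall n, (1 + freqNormSq k) ^ m * ‖coeffExt (freqBall n) (β n t) k‖ ^ 2 ≤ Rm := by
    intro m
    rcases le_or_gt 4 m with hm | hm
    · exact hR4 m hm
    · obtain ⟨R4, hR40, hR4b⟩ := hR4 4 le_rfl
      exact ⟨R4, hR40, fun n t ht => (sum_weight_pow_mul_norm_sq_mono (freqBall n) _ hm.le).trans (hR4b n t ht)⟩
  choose R hR0 hR using hRall
  -- Step 3: the Cauchy bound
  set K : ℝ := 2 * (Fintype.card d * Real.sqrt B * (2 * Real.pi) * Real.sqrt (R 3)) with hK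
  set εn : ℕ → ℝ := fun n => 2 * (Real.sqrt B * Real.sqrt (R 3) * (Fintype.card d * ((2 * Real.pi) * Real.sqrt (R 3)) *
      Real.sqrt (((1 + (n : ℝ) ^ 2) ^ 1)⁻¹ * R 1))) with hεn
  set η : ℕ → ℝ := fun n => (((1 + (n : ℝ) ^ 2) ^ 1)⁻¹ * U 1 + εn n * T) * Real.exp (K * T) with hη
  have hK0 : 0 ≤ K := by rw [hK]; positivity
  have hεn0 : ∀ n, 0 ≤ εn n := fun n => by simp only [hεn]; positivity
  have hU0 : ∀ m, 0 ≤ U m := fun m => le_trans (by simp) (hU m ∅)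
  have hη0 : ∀ n, 0 ≤ η n := fun n => by
    simp only [hη]
    have := hU0 1; have := hεn0 n; positivity
  have hcauchy : ∀ n n', n ≤ n' → ∀ t ∈ Icc 0 T,
      ∑ k : ↥(freqBall (d := d) n'), ‖β n' t k - coeffExt (freqBall n) (β n t) (k : d → ℤ)‖ ^ 2 ≤ η n := by
    intro n n' hnn' t ht
    have h := galerkin_cauchy_estimate hnn' hν hσ (hB _) (hβderiv n T) (fun t _ => hβmem n t) (hβderiv n' T)
      (fun t _ => hβmem n' t) (R := R 3) (fun t ht => hR 3 n' t ht)
      (fun t ht => (sum_weight_pow_mul_norm_sq_mono _ _ (by norm_num : 2 ≤ 3)).trans (hR 3 n t ht))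
      (s := 1) (Rs := R 1) (fun t ht => hR 1 n' t ht) t ht
    refine h.trans ?_
    have hE0 : ∑ k : ↥(freqBall (d := d) n'), ‖β n' 0 k - coeffExt (freqBall n) (β n 0) (k : d → ℤ)‖ ^ 2 ≤
        ((1 + (n : ℝ) ^ 2) ^ 1)⁻¹ * U 1 := by
      rw [hβ0 n', hβ0 n]
      have heq : ∑ k : ↥(freqBall (d := d) n'), ‖a k - coeffExt (freqBall n) (fun k : ↥(freqBall (d := d) n) => a k) (k : d → ℤ)‖ ^ 2 =
          ∑ k ∈ freqBall n', (if k ∈ freqBall n then 0 else ‖a k‖ ^ 2) := by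
        rw [← Finset.sum_coe_sort (freqBall n')]
        refine Finset.sum_congr rfl fun k _ => ?_
        by_cases hk : (k : d → ℤ) ∈ freqBall n
        · rw [if_pos hk, coeffExt_of_mem _ hk, sub_self, norm_zero, sq, mul_zero]
        · rw [if_neg hk, coeffExt_of_not_mem _ hk, sub_zero]
      rw [heq]
      exact (tail_le n a 1).trans (mul_le_mul_of_nonneg_left (hU 1 _) (inv_nonneg.2 (by positivity)))
    have hE0nn : 0 ≤ ∑ k : ↥(freqBall (d := d) n'), ‖β n' 0 k - coeffExt (freqBall n) (β n 0) (k : d → ℤ)‖ ^ 2 :=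
      Finset.sum_nonneg fun k _ => sq_nonneg _
    calc gronwallBound (∑ k : ↥(freqBall (d := d) n'), ‖β n' 0 k - coeffExt (freqBall n) (β n 0) (k : d → ℤ)‖ ^ 2) K (εn n) t
        ≤ ((∑ k : ↥(freqBall (d := d) n'), ‖β n' 0 k - coeffExt (freqBall n) (β n 0) (k : d → ℤ)‖ ^ 2) + εn n * t) *
            Real.exp (K * t) := gronwallBound_le_mul_exp hK0 (hεn0 n) ht.1
      _ ≤ (((1 + (n : ℝ) ^ 2) ^ 1)⁻¹ * U 1 + εn n * T) * Real.exp (K * T) := by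
          refine mul_le_mul (add_le_add hE0 (mul_le_mul_of_nonneg_left ht.2 (hεn0 n)))
            (Real.exp_le_exp.2 (mul_le_mul_of_nonneg_left ht.2 hK0)) (Real.exp_pos _).le ?_
          have := hU0 1; have := hεn0 n; positivity
  -- Step 4: the approximants at a fixed mode, their limit
  set f : ℕ → ℝ → (d → ℤ) → EuclideanSpace ℂ d := fun n t k => coeffExt (freqBall n) (β n t) k with hf
  have hfdiff : ∀ n n', n ≤ n' → ∀ t ∈ Icc 0 T, ∀ k, ‖f n' t k - f n t k‖ ^ 2 ≤ η n := by
    intro n n' hnn' t ht k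
    by_cases hk : k ∈ freqBall (d := d) n'
    · have h1 := hcauchy n n' hnn' t ht
      have h2 : ‖β n' t ⟨k, hk⟩ - coeffExt (freqBall n) (β n t) k‖ ^ 2 ≤
          ∑ k : ↥(freqBall (d := d) n'), ‖β n' t k - coeffExt (freqBall n) (β n t) (k : d → ℤ)‖ ^ 2 :=
        Finset.single_le_sum (f := fun k' : ↥(freqBall (d := d) n') =>
          ‖β n' t k' - coeffExt (freqBall n) (β n t) (k' : d → ℤ)‖ ^ 2) (fun _ _ => sq_nonneg _) (Finset.mem_univ _)
      simp only [hf, coeffExt_of_mem _ hk]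
      exact h2.trans h1
    · have hk' : k ∉ freqBall (d := d) n := fun h => hk (freqBall_mono hnn' h)
      simp only [hf, coeffExt_of_not_mem _ hk, coeffExt_of_not_mem _ hk', sub_self, norm_zero]
      simpa using hη0 n
  -- `η → 0`
  have hx : Tendsto (fun n : ℕ => ((1 + (n : ℝ) ^ 2) ^ 1)⁻¹) atTop (𝓝 0) := by
    simp only [pow_one]
    refine tendsto_inv_atTop_zero.comp ?_
    refine Filter.tendsto_atTop_mono (fun n => ?_) tendsto_natCast_atTop_atTop
    nlinarith [sq_nonneg ((n : ℝ) - 1)]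
  have hεt : Tendsto εn atTop (𝓝 0) := by
    have h1 : Tendsto (fun n : ℕ => Real.sqrt (((1 + (n : ℝ) ^ 2) ^ 1)⁻¹ * R 1)) atTop (𝓝 0) := by
      have := (hx.mul_const (R 1)).sqrt
      simpa using this
    have h2 := h1.const_mul (2 * (Real.sqrt B * Real.sqrt (R 3) * (Fintype.card d * ((2 * Real.pi) * Real.sqrt (R 3)))))
    rw [mul_zero] at h2
    refine h2.congr fun n => ?_
    simp only [hεn]; ring
  have hηt : Tendsto η atTop (𝓝 0) := by
    have h := ((hx.mul_const (U 1)).add (hεt.mul_const T)).mul_const (Real.exp (K * T))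
    simpa [hη] using h
  -- pointwise Cauchy sequences and the limit
  have hsqrt : ∀ n n', n ≤ n' → ∀ t ∈ Icc 0 T, ∀ k, ‖f n' t k - f n t k‖ ≤ Real.sqrt (η n) := by
    intro n n' hnn' t ht k
    have h := Real.sqrt_le_sqrt (hfdiff n n' hnn' t ht k)
    rwa [Real.sqrt_sq (norm_nonneg _)] at h
  have hcs : ∀ t ∈ Icc 0 T, ∀ k, CauchySeq fun n => f n t k := by
    intro t ht k
    refine cauchySeq_of_le_tendsto_0 (fun N => 2 * Real.sqrt (η N)) (fun n m N hNn hNm => ?_) ?_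
    · rw [dist_eq_norm]
      calc ‖f n t k - f m t k‖ = ‖(f n t k - f N t k) - (f m t k - f N t k)‖ := by abel_nf
        _ ≤ ‖f n t k - f N t k‖ + ‖f m t k - f N t k‖ := norm_sub_le _ _
        _ ≤ Real.sqrt (η N) + Real.sqrt (η N) := add_le_add (hsqrt N n hNn t ht k) (hsqrt N m hNm t ht k)
        _ = 2 * Real.sqrt (η N) := by ring
    · have := hηt.sqrt
      rw [Real.sqrt_zero] at this
      simpa using this.const_mul 2
  set c : ℝ → (d → ℤ) → EuclideanSpace ℂ d := fun t k => limUnder atTop (fun n => f n t k) with hc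
  have hconv : ∀ t ∈ Icc 0 T, ∀ k, Tendsto (fun n => f n t k) atTop (𝓝 (c t k)) := fun t ht k =>
    (hcs t ht k).tendsto_limUnder
  have herr : ∀ n, ∀ t ∈ Icc 0 T, ∀ k, ‖c t k - f n t k‖ ^ 2 ≤ η n := by
    intro n t ht k
    have hlim : Tendsto (fun n' => ‖f n' t k - f n t k‖ ^ 2) atTop (𝓝 (‖c t k - f n t k‖ ^ 2)) :=
      (((hconv t ht k).sub_const _).norm).pow 2
    exact le_of_tendsto hlim (Filter.eventually_atTop.2 ⟨n, fun n' hn' => hfdiff n n' hn' t ht k⟩)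
  -- continuity of the approximants and of the limit
  have hfcont : ∀ n k, Continuous fun t => f n t k := by
    intro n k
    by_cases hk : k ∈ freqBall (d := d) n
    · simp only [hf, coeffExt_of_mem _ hk]
      exact (continuous_apply _).comp (hβcont n)
    · simp only [hf, coeffExt_of_not_mem _ hk]
      exact continuous_const
  have hunif : ∀ k, TendstoUniformlyOn (fun n t => f n t k) (fun t => c t k) atTop (Icc 0 T) := by
    intro k
    refine Metric.tendstoUniformlyOn_iff.2 fun ε hε => ?_
    have hev : ∀ᶠ n in atTop, η n < ε ^ 2 := hηt.eventually (gt_mem_nhds (by positivity))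
    filter_upwards [hev] with n hn t ht
    rw [dist_eq_norm]
    have h1 : ‖c t k - f n t k‖ ^ 2 < ε ^ 2 := (herr n t ht k).trans_lt hn
    exact (pow_lt_pow_iff_left₀ (norm_nonneg _) hε.le two_ne_zero).1 h1
  have hccont : ∀ k, ContinuousOn (fun t => c t k) (Icc 0 T) := fun k =>
    (hunif k).continuousOn (Filter.Eventually.of_forall fun n => (hfcont n k).continuousOn).frequently
  -- Step 5: the properties of the limit
  have hmemIcc0 : (0 : ℝ) ∈ Icc 0 T := ⟨le_rfl, hT0⟩
  have hc0 : c 0 = a := by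
    funext k
    obtain ⟨N, hN⟩ := exists_mem_freqBall k
    have hev : ∀ᶠ n in atTop, f n 0 k = a k := Filter.eventually_atTop.2 ⟨N, fun n hn => by
      simp only [hf, hβ0 n, coeffExt_of_mem _ (freqBall_mono hn hN)]⟩
    exact tendsto_nhds_unique (hconv 0 hmemIcc0 k) (tendsto_const_nhds.congr' (hev.mono fun n hn => hn.symm))
  have hcconj : ∀ t ∈ Icc 0 T, IsConjSymm (c t) := by
    intro t ht k
    have h1 : ∀ n, f n t (-k) = FunctionSpaces.EuclideanSpace.conjVec (f n t k) := fun n =>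
      (hβmem n t).1.isConjSymm_coeffExt (hS n) k
    have h2 : Tendsto (fun n => FunctionSpaces.EuclideanSpace.conjVec (f n t k)) atTop
        (𝓝 (FunctionSpaces.EuclideanSpace.conjVec (c t k))) :=
      (FunctionSpaces.EuclideanSpace.conjVecL.continuous.tendsto _).comp (hconv t ht k)
    exact tendsto_nhds_unique (hconv t ht (-k)) (h2.congr fun n => (h1 n).symm)
  have hctrans : ∀ t ∈ Icc 0 T, ∀ k : d → ℤ, ∑ j, (k j : ℂ) * c t k j = 0 := by
    intro t ht k
    have h1 : ∀ n, ∑ j, (k j : ℂ) * f n t k j = 0 := fun n =>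
      isTransversal_coeffExt_of_subset (S' := {k}) (hβmem n t).2 k (Finset.mem_singleton_self k)
    have hL : Continuous fun v : EuclideanSpace ℂ d => ∑ j, (k j : ℂ) * v j :=
      continuous_finsetSum _ fun j _ => continuous_const.mul (PiLp.continuous_apply 2 _ j)
    have h2 : Tendsto (fun n => ∑ j, (k j : ℂ) * f n t k j) atTop (𝓝 (∑ j, (k j : ℂ) * c t k j)) :=
      (hL.tendsto _).comp (hconv t ht k)
    exact tendsto_nhds_unique h2 (by simp only [h1]; exact tendsto_const_nhds)
  have hcbound : ∀ m, ∀ t ∈ Icc 0 T, ∀ F : Finset (d → ℤ), ∑ k ∈ F, (1 + freqNormSq k) ^ m * ‖c t k‖ ^ 2 ≤ R m := by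
    intro m t ht F
    have h1 : ∀ n, ∑ k ∈ F, (1 + freqNormSq k) ^ m * ‖f n t k‖ ^ 2 ≤ R m := fun n =>
      (sum_coeffExt_le_sum (F := F) (fun k => (1 + freqNormSq k) ^ m)
        (fun k => pow_nonneg (by linarith [freqNormSq_nonneg k]) _) (β n t)).trans (hR m n t ht)
    have h2 : Tendsto (fun n => ∑ k ∈ F, (1 + freqNormSq k) ^ m * ‖f n t k‖ ^ 2) atTop
        (𝓝 (∑ k ∈ F, (1 + freqNormSq k) ^ m * ‖c t k‖ ^ 2)) :=
      tendsto_finsetSum _ fun k _ => (((hconv t ht k).norm).pow 2).const_mul _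
    exact le_of_tendsto' h2 h1
  exact ⟨β, c, R, η, hβ0, hβmem, hβcont, hβderiv, hR0, hR, hη0, hηt,
    fun n t ht k => by rw [hf] at herr; exact herr n t ht k, hc0, hcconj, hctrans, hcbound, hccont⟩

end Limit

end GalerkinSmooth

end Literature.Analysis.FluidPDE
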